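import Summits.FinalStateConjecture.FinalStateConjecture.Theorems.BartnikGapSettlingBondiBartnikRigidityMarchingLemmaKiteRealise
import Summits.FinalStateConjecture.FinalStateConjecture.Theorems.BartnikGapSettlingBondiBartnikRigidityMarchingLemmaKiteChart
import Summits.FinalStateConjecture.FinalStateConjecture.Theorems.BartnikGapSettlingBondiBartnikRigidityMarchingLemmaChartData
import Summits.FinalStateConjecture.FinalStateConjecture.Theorems.BartnikGapSettlingBondiBartnikRigidityMarchingLemmaChartCausal
import Summits.FinalStateConjecture.FinalStateConjecture.Theorems.BartnikGapSettlingBondiBartnikRigidityMarchingLemmaChartGlue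
import Summits.FinalStateConjecture.FinalStateConjecture.Theorems.BartnikGapSettlingBondiBartnikRigidityMarchingLemmaAgreeVertical
import Summits.FinalStateConjecture.FinalStateConjecture.Theorems.BartnikGapSettlingBondiBartnikRigidityMarchingLemmaLevelConnected
import Summits.FinalStateConjecture.FinalStateConjecture.Theorems.BartnikGapSettlingBondiBartnikRigidityMarchingLemmaSlabFutureGeometry
import Literature.Geometry.Lorentzian.KerrSliceFacts
import HarnessLib

/-!
# K2b-5 `stub_marchingLemma`, brick 21: the kite piece of one marching step — line
# `direct-method-on-the-cone` (crux `BondiBartnikRigidity`, stmt-FinalStateConjecture-10807)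

`kite_step` assembles bricks 2–6, 9–12, 19 into the new chart of one step of the marching (report K2b-a2
§4): given the chart `Ψ` of the invariant at level `τ` on `pullK Q` (exact, time-orientation preserving,
open embedding, image in `J⁺(C)`, with past-closed image — the conclusion of `K2Route.ExactChartPastSet`
— and image in `I⁺(C)`), the collar set `F ⊆ Q` (vertically closed in `W`) and `W ∩ {t* < τ} ⊆ Q`, it
erects the kite `K` of height `h` over the (connected, brick 19) level set `{t* = τ − h/2} ∩ W`, realises
its Kerr development inside the maximal `𝒱` over the exact image of the level (bricks 4–6, engine), reads
the realisation as an exact chart `Ψ'` on `pullK K` (brick 9), and proves: `Ψ' = Ψ` on `pullK (Q ∩ K)`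
(rigidity below level `τ`, brick 6; along vertical segments on `K ∩ F`, brick 12), the cross-injectivity
`Ψ x = Ψ' x' ⇒ x' ∈ pullK Q` (brick 11), `Ψ'(pullK K) ⊆ J⁺(C)`, `Ψ' = Ψ` off `pullK K`, and the covering
criterion "a point of `W ∩ {τ − h/2 ≤ t* < τ + h/2}` whose cut backward cone rests on the level set lies
in `K`".

References: Dafermos–Rodnianski arXiv:0811.0354, §5.1 [DafermosRodnianski2008]; Choquet-Bruhat–Geroch
1969, Thm. 3 [ChoquetBruhatGeroch1969CMP]; Sbierski 2016, §3.1 [Sbierski2016AHP].  No definitions, no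
named facts.
-/

noncomputable section

-- D-0017: single-problem summit, `Summit.<S>.<S>.…` by design (cf. lakefile `weak.linter.dupNamespace`).
set_option linter.dupNamespace false
set_option maxSynthPendingDepth 3

open Set Filter Function Topology TopologicalSpace Bundle
open Literature.Geometry.Lorentzian
open scoped Manifold ContDiff Topology ENNReal

namespace Summit.FinalStateConjecture.FinalStateConjecture.Theorems.BondiBartnikRigidity.DirectMethod

namespace StepK

open ChartData (lab_mem_pullK_iff contMDiffAt_chart val_mfderiv_chart)
open FutureK (translate_mem_region)

variable {X : Type} [TopologicalSpace X] [ChartedSpace E3 X] [IsManifold (𝓡 3) ∞ X]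
  [T2Space X] [SecondCountableTopology X] [ConnectedSpace X] {D : InitialDataSet (𝓡 3) X}

set_option maxHeartbeats 3200000 in
/-- **The kite piece of one marching step** (see the module docstring). [cite: DafermosRodnianski2008, §5.1] -/
theorem kite_step (hcbg : choquetBruhat_geroch_exists_mghd_cauchy) (hglue : K2Route.ExactChartGluing)
    [Kerr.Facts] (𝒱 : VacuumCauchyDevelopment D) (hmax : 𝒱.IsMaximal)
    {M a : ℝ} (hM : 0 < M) (ha : |a| < M) {mo : lorentzGroup × E4} {B : ModelBackground}
    (hB : B = starBackground mo.1 mo.2 M a (fun x => Kerr.radius a (poincareInv mo.1 mo.2 x)))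
    {lab : Kerr.region a M → B.domain} (hlab : ∀ z, (lab z : E4) = (mo.1 : E4 ≃L[ℝ] E4) z.1 + mo.2)
    (hcyl : {y : Kerr.region a M | 0 ≤ y.1 0 ∧ Kerr.radius a y.1 ≤ 3 * M} ⊆ JK M a hM (slabK M a))
    (hfr : frontier (JK M a hM (slabK M a)) ⊆ slabK M a ∪ JK M a hM (outerSphereK M a))
    {C : Set 𝒱.carrier} {Q F : Set (Kerr.region a M)} (hQo : IsOpen Q) (hFo : IsOpen F) (hFQ : F ⊆ Q)
    {h τ : ℝ} (hh : 0 < h) (hτ : 2 * h ≤ τ)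
    (hQlow : interior (JK M a hM (slabK M a)) ∩ {y | y.1 0 < τ} ⊆ Q) (hQF : Q ⊆ {y | y.1 0 < τ} ∪ F)
    (hFvert : ∀ z ∈ F, ∀ u : ℝ, 0 ≤ u →
      (⟨z.1 + (-u) • E4.basisVector 0, translate_mem_region z (-u)⟩ : Kerr.region a M) ∈
        interior (JK M a hM (slabK M a)) →
      (⟨z.1 + (-u) • E4.basisVector 0, translate_mem_region z (-u)⟩ : Kerr.region a M) ∈ F)
    {Ψ : B.domain → 𝒱.carrier}
    (hs : ContMDiffOn 𝓘(ℝ, E4) (𝓡 4) ∞ Ψ (pullK mo M a B Q))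
    (he : IsOpenEmbedding ((pullK mo M a B Q).restrict Ψ))
    (himg : Ψ '' pullK mo M a B Q ⊆ 𝒱.metric.causalFuture 𝒱.timeOrientation C)
    (hd : supCkENorm (Subtype.val '' pullK mo M a B Q) 0 (𝒱.toSpacetime.deviationExtend B Ψ) ≤ 0)
    (htop : ∀ x ∈ pullK mo M a B Q, 𝒱.timeOrientation.IsFutureDirected
      (mfderiv 𝓘(ℝ, E4) (𝓡 4) Ψ x ((mo.1 : E4 ≃L[ℝ] E4) (Kerr.timeVector M a (poincareInv mo.1 mo.2 x.1)))))
    (hpast : ∀ x ∈ pullK mo M a B Q, 𝒱.metric.causalPast 𝒱.timeOrientation {Ψ x} ∩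
      𝒱.metric.chronologicalFuture 𝒱.timeOrientation C ⊆ Ψ '' pullK mo M a B Q)
    (hQI : Ψ '' pullK mo M a B Q ⊆ 𝒱.metric.chronologicalFuture 𝒱.timeOrientation C) :
    ∃ (U : Set (Kerr.region a M)) (Ψ' : B.domain → 𝒱.carrier),
      IsOpen U ∧ U ⊆ interior (JK M a hM (slabK M a)) ∧
      -- covering criterion
      (∀ x ∈ interior (JK M a hM (slabK M a)), τ - h / 2 ≤ x.1 0 → x.1 0 < τ + h / 2 →
        (∀ z : E3, ‖z - E4.spatial x.1‖ ≤ x.1 0 - (τ - h / 2) →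
          min (Kerr.radius a x.1) (Kerr.rPlus M a) ≤ Kerr.radius a (E4.ofTimeSpace 0 z) →
          ∃ hz : E4.ofTimeSpace (τ - h / 2) z ∈ Kerr.region a M,
            (⟨E4.ofTimeSpace (τ - h / 2) z, hz⟩ : Kerr.region a M) ∈ interior (JK M a hM (slabK M a))) →
        x ∈ U) ∧
      -- the new exact chart on `pullK U`
      ContMDiffOn 𝓘(ℝ, E4) (𝓡 4) ∞ Ψ' (pullK mo M a B U) ∧
      IsOpenEmbedding ((pullK mo M a B U).restrict Ψ') ∧
      Ψ' '' pullK mo M a B U ⊆ 𝒱.metric.causalFuture 𝒱.timeOrientation C ∧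
      supCkENorm (Subtype.val '' pullK mo M a B U) 0 (𝒱.toSpacetime.deviationExtend B Ψ') ≤ 0 ∧
      (∀ x ∈ pullK mo M a B U, 𝒱.timeOrientation.IsFutureDirected
        (mfderiv 𝓘(ℝ, E4) (𝓡 4) Ψ' x ((mo.1 : E4 ≃L[ℝ] E4) (Kerr.timeVector M a (poincareInv mo.1 mo.2 x.1))))) ∧
      -- agreement, cross-injectivity, off-domain values
      (∀ x ∈ pullK mo M a B Q, x ∈ pullK mo M a B U → Ψ x = Ψ' x) ∧
      (∀ x ∈ pullK mo M a B Q, ∀ x' ∈ pullK mo M a B U, Ψ x = Ψ' x' → x' ∈ pullK mo M a B Q) ∧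
      (∀ x, x ∉ pullK mo M a B U → Ψ' x = Ψ x) := by
  classical
  haveI : Kerr.SliceFacts := Kerr.sliceFacts_holds
  have hn1 : (1 : ℕ∞ω) ≤ (∞ : ℕ∞ω) := by exact_mod_cast le_top
  set W := interior (JK M a hM (slabK M a)) with hWdef
  set σ := τ - h / 2 with hσ
  have hσ0 : 0 < σ := by rw [hσ]; linarith
  have hστ : σ < τ := by rw [hσ]; linarith
  have hmax' : max M 0 = M := max_eq_left hM.le
  /- ### the level set `N = {z : (σ, z) ∈ W}` and the W-facts -/
  obtain ⟨hNo, hNc⟩ := LevelK.isConnected_levelSet hM ha hcyl hfr hσ0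
  set Nset : Set E3 := {z : E3 | ∃ hz : E4.ofTimeSpace σ z ∈ Kerr.region a M,
    (⟨E4.ofTimeSpace σ z, hz⟩ : Kerr.region a M) ∈ W} with hNset
  set N : Opens E3 := ⟨Nset, hNo⟩ with hNdef
  have hNmem : ∀ z : E3, z ∈ (N : Set E3) ↔ ∃ hz : E4.ofTimeSpace σ z ∈ Kerr.region a M,
      (⟨E4.ofTimeSpace σ z, hz⟩ : Kerr.region a M) ∈ W := fun z => Iff.rfl
  haveI : ConnectedSpace N := isConnected_iff_connectedSpace.1 hNc
  have hN : N ≤ Kerr.slice a M := by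
    rintro z ⟨hz, -⟩
    rw [Kerr.mem_slice_iff_ofTimeSpace_mem_region, Kerr.mem_region, hmax',
      ← Kerr.radius_eq_of_spatial_eq a (x := E4.ofTimeSpace σ z) (by rw [E4.spatial_ofTimeSpace, E4.spatial_ofTimeSpace])]
    rw [Kerr.mem_region, hmax'] at hz; exact hz
  have hW : ∀ x ∈ W, (Kerr.smoothMetric M a M).chronologicalFuture ((Kerr.timeOrientation M a M hM.le).ofLE le_top) {x} ⊆ W :=
    fun x hx => FutureK.chronologicalFuture_subset_interior_JK hM (interior_subset hx)
  have hWup : ∀ y ∈ W, ∀ u : ℝ, 0 ≤ u →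
      (⟨(y : E4) + u • E4.basisVector 0, Kerr.add_smul_basisVector_zero_mem_region y.2 u⟩ : Kerr.region a M) ∈ W :=
    fun y hy u hu => FutureK.interior_JK_slabK_translate_subset hM hcyl hu hy
  have hSliceW : ∀ y : Kerr.region a M, (y : E4) 0 = σ → E4.spatial (y : E4) ∈ (N : Set E3) → y ∈ W := by
    rintro y hy ⟨hz, hzW⟩
    have : (⟨E4.ofTimeSpace σ (E4.spatial y.1), hz⟩ : Kerr.region a M) = y :=
      Subtype.ext (by rw [← hy]; exact E4.ofTimeSpace_time_spatial y.1)
    rw [← this]; exact hzW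
  /- ### the kite -/
  set U : Opens (Kerr.spacetime M a M hM.le).carrier :=
    ⟨{y : Kerr.region a M |
      (σ ≤ (y : E4) 0 ∧ (y : E4) 0 < σ + h ∧ ∀ z : E3, ‖z - E4.spatial (y : E4)‖ ≤ (y : E4) 0 - σ →
        min (Kerr.radius a (y : E4)) (Kerr.rPlus M a) ≤ Kerr.radius a (E4.ofTimeSpace 0 z) → z ∈ (N : Set E3)) ∨
      (y ∈ W ∧ σ - h < (y : E4) 0 ∧ (y : E4) 0 < σ ∧
        σ + 2 / 3 * M < (y : E4) 0 + 2 / 3 * Kerr.radius a (y : E4) ∧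
        ∀ z : E3, ‖z - E4.spatial (y : E4)‖ ≤ σ - (y : E4) 0 → z ∈ (N : Set E3))},
      KerrKite.isOpen_kite hh hh hNo isOpen_interior hSliceW⟩ with hUdef
  have hU : ∀ y : Kerr.region a M, y ∈ U ↔
      (σ ≤ (y : E4) 0 ∧ (y : E4) 0 < σ + h ∧ ∀ z : E3, ‖z - E4.spatial (y : E4)‖ ≤ (y : E4) 0 - σ →
        min (Kerr.radius a (y : E4)) (Kerr.rPlus M a) ≤ Kerr.radius a (E4.ofTimeSpace 0 z) → z ∈ (N : Set E3)) ∨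
      (y ∈ W ∧ σ - h < (y : E4) 0 ∧ (y : E4) 0 < σ ∧
        σ + 2 / 3 * M < (y : E4) 0 + 2 / 3 * Kerr.radius a (y : E4) ∧
        ∀ z : E3, ‖z - E4.spatial (y : E4)‖ ≤ σ - (y : E4) 0 → z ∈ (N : Set E3)) := fun y => Iff.rfl
  set US : Set (Kerr.region a M) := (U : Set (Kerr.spacetime M a M hM.le).carrier) with hUS
  have hUSmem : ∀ y : Kerr.region a M, y ∈ US ↔ y ∈ U := fun y => Iff.rfl
  -- upper points are in `W`; the kite lies in `W`; points of the kite below `τ` are in `Q`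
  have hupW : ∀ y : Kerr.region a M, σ ≤ (y : E4) 0 → (∀ z : E3, ‖z - E4.spatial (y : E4)‖ ≤ (y : E4) 0 - σ →
      min (Kerr.radius a (y : E4)) (Kerr.rPlus M a) ≤ Kerr.radius a (E4.ofTimeSpace 0 z) → z ∈ (N : Set E3)) → y ∈ W := by
    intro y hy hcone
    have hsp : E4.spatial y.1 ∈ (N : Set E3) := hcone _ (by rw [sub_self, norm_zero]; linarith)
      (by rw [Kerr.radius_ofTimeSpace_spatial]; exact min_le_left _ _)
    have hbase := hSliceW ⟨E4.ofTimeSpace σ (E4.spatial y.1), KerrKite.ofTimeSpace_spatial_mem_region y σ⟩ rfl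
      (by rw [E4.spatial_ofTimeSpace]; exact hsp)
    have h := hWup _ hbase (y.1 0 - σ) (by linarith)
    convert h using 1
    refine Subtype.ext ?_
    show y.1 = E4.ofTimeSpace σ (E4.spatial y.1) + (y.1 0 - σ) • E4.basisVector 0
    rw [Kerr.ofTimeSpace_add_smul_basisVector_zero, show σ + (y.1 0 - σ) = y.1 0 by ring]
    exact (E4.ofTimeSpace_time_spatial y.1).symm
  have hUW : US ⊆ W := by
    intro y hy
    rcases (hU y).1 hy with hup | hlow
    · exact hupW y hup.1 hup.2.2
    · exact hlow.1
  have hUlowQ : ∀ y : Kerr.region a M, y ∈ U → (y : E4) 0 < τ → y ∈ Q := fun y hy hyt => hQlow ⟨hUW hy, hyt⟩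
  /- ### the level embedding and the `𝒱`-side datum -/
  have hSr : ∀ z ∈ (N : Set E3), E4.ofTimeSpace σ z ∈ Kerr.region a M := fun z hz => hz.1
  set jK : N → Kerr.region a M := fun y => ⟨E4.ofTimeSpace σ y.1, hSr y.1 y.2⟩ with hjKdef
  have hjK : ∀ y, (jK y : E4) = E4.ofTimeSpace σ (y : E3) := fun y => rfl
  set νK : NormalField 𝓘(ℝ, E4) jK := fun y => Kerr.sliceNormal M a M (Opens.inclusion hN y) with hνKdef
  have hνK : ∀ y, νK y = Kerr.sliceNormal M a M (Opens.inclusion hN y) := fun y => rfl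
  have hjW : ∀ y, jK y ∈ W := fun y => (y.2).2
  have hjQ : ∀ y, jK y ∈ Q := fun y => hQlow ⟨hjW y, by show (E4.ofTimeSpace σ y.1) 0 < τ; rw [E4.ofTimeSpace_apply_zero]; exact hστ⟩
  set j : N → 𝒱.carrier := Ψ ∘ lab ∘ jK with hjdef
  set ν : NormalField (𝓡 4) j := fun y => mfderiv 𝓘(ℝ, E4) (𝓡 4) Ψ (lab (jK y)) ((mo.1 : E4 ≃L[ℝ] E4) (νK y))
    with hνdef
  have hjemb := ChartData.chart_isSmoothEmbedding (𝒮 := 𝒱.toSpacetime) hM.le hlab hQo hB hs he hd hN hjK hjQ hνK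
  have hνfun := ChartData.chart_isFutureUnitNormal (𝒮 := 𝒱.toSpacetime) hM.le hlab hQo hB hs hd htop hN hjK hjQ hνK
  have hhfun := ChartData.chart_induced_h (𝒮 := 𝒱.toSpacetime) hM.le hlab hQo hB hs hd hN hjK hjQ
  have hkfun : ∀ [𝒱.metric.toPseudoRiemannianMetric.HasLeviCivita] (y : N),
      𝒱.metric.toPseudoRiemannianMetric.secondFundamentalForm (𝓡 3) j ν y =
        ((Kerr.data M a M hM.le).comap (Opens.inclusion hN) (contMDiff_inclusion hN)
          (KerrLevel.injective_mfderiv_inclusion hN)).kBilin y := by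
    intro inst y
    exact ChartData.chart_induced_k (𝒮 := 𝒱.toSpacetime) hM.le hlab hQo hB hs hd hN hjK hjQ hνK y
  -- acausality of the level image
  have hinj : InjOn Ψ (pullK mo M a B Q) := fun x hx y hy hxy =>
    congrArg Subtype.val (he.injective (a₁ := ⟨x, hx⟩) (a₂ := ⟨y, hy⟩) hxy)
  have hac : ∀ p ∈ Set.range j, ∀ q ∈ Set.range j, q ∈ 𝒱.metric.causalFuture 𝒱.timeOrientation {p} → q = p := by
    rintro _ ⟨y₁, rfl⟩ _ ⟨y₂, rfl⟩ hq
    have := ChartCausal.eq_of_mem_causalFuture_of_time_le (𝒮 := 𝒱.toSpacetime) hM hlab hQo hB hs hinj hd htop hpast hQI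
      (hjQ y₁) (hjQ y₂) hq (by show (E4.ofTimeSpace σ y₂.1) 0 ≤ (E4.ofTimeSpace σ y₁.1) 0; simp [E4.ofTimeSpace_apply_zero])
    show (Ψ ∘ lab ∘ jK) y₂ = (Ψ ∘ lab ∘ jK) y₁
    simp only [comp_apply]; rw [this]
  /- ### the kite realised, rigidity below `τ` -/
  obtain ⟨Θ, hΘs, hΘo, hΘi, hΘt, hΘj, hΘup⟩ := KiteRealise.kite_realised hcbg 𝒱 hmax hM ha hh N hNc hN hW hWup U hU
    hjK hνK hjemb hνfun hhfun hkfun hac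
  have hrig := KiteRealise.kite_chart_unique 𝒱 hM (hp' := h / 2) (by linarith) (by linarith) N hNc hN hWup U hU hjK hνK
    hjemb hνfun hhfun hkfun hΘs hΘi hΘt hΘj (Φ := Ψ ∘ lab) (fun z hz hzt => by
      have hzt' : (z : E4) 0 < τ := by rw [hσ] at hzt; linarith
      have hzQ : z ∈ Q := hUlowQ z hz hzt'
      obtain ⟨hat, hdΦ⟩ := contMDiffAt_chart hlab hQo hB hs hzQ
      refine ⟨hat, fun u u' => val_mfderiv_chart hlab hQo hB hs hd hzQ u u', ?_⟩
      rw [hdΦ]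
      have h1 := htop (lab z) ((lab_mem_pullK_iff hlab z).2 hzQ)
      have hP : poincareInv mo.1 mo.2 (lab z).1 = z.1 := by rw [hlab, F1Route.poincareInv_lab]
      rw [hP] at h1; exact h1) (fun y => rfl)
  -- `Θ = Ψ ∘ lab` on `U ∩ {t* < τ}`
  have hagree_low : ∀ z : U, (z.1.1 : E4) 0 < τ → Θ z = Ψ (lab z.1) := fun z hz =>
    hrig z (by show (z.1.1 : E4) 0 < σ + h / 2; rw [hσ]; linarith)
  /- ### the kite chart -/
  obtain ⟨Ψ', hs', he', hd', htop', hread, hoff⟩ :=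
    KiteChart.chart_of_isometricEmbedding (𝒮 := 𝒱.toSpacetime) hM hB U hΘs hΘo hΘi hΘt Ψ
  have hΨ'lab : ∀ (z : Kerr.region a M) (hz : z ∈ U), Ψ' (lab z) = Θ ⟨z, hz⟩ := fun z hz => hread z hz (lab z) (hlab z)
  /- ### agreement on `U ∩ F` along vertical segments -/
  have hagreeF : ∀ z ∈ US ∩ F, Ψ' (lab z) = Ψ (lab z) := by
    refine AgreeVertical.agree_of_vertical (𝒮 := 𝒱.toSpacetime) hglue hM ha hlab hB U.2 hFo hFQ hs' hd' hs hd hστ ?_ ?_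
    · -- vertical segments stay in `U ∩ F`
      rintro z ⟨hzU, hzF⟩ hτz t' ht'
      rcases (hU z).1 hzU with hup | hlow
      swap
      · exfalso; linarith [hlow.2.2.1]
      obtain ⟨hσz, hzh, hcone⟩ := hup
      set z' : Kerr.region a M := ⟨z.1 + (t' - z.1 0) • E4.basisVector 0,
        Kerr.add_smul_basisVector_zero_mem_region z.2 _⟩ with hz'
      have hz't : (z' : E4) 0 = t' := by simp [hz', E4.basisVector]
      have hz's : E4.spatial (z' : E4) = E4.spatial z.1 := by
        simp [hz', E4.basisVector, map_add, map_smul]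
      have hz'r : Kerr.radius a (z' : E4) = Kerr.radius a z.1 := Kerr.radius_add_time_smul_basisVector a z.1 _
      have hup' : σ ≤ (z' : E4) 0 ∧ (z' : E4) 0 < σ + h ∧ ∀ w : E3, ‖w - E4.spatial (z' : E4)‖ ≤ (z' : E4) 0 - σ →
          min (Kerr.radius a (z' : E4)) (Kerr.rPlus M a) ≤ Kerr.radius a (E4.ofTimeSpace 0 w) → w ∈ (N : Set E3) := by
        refine ⟨by rw [hz't]; exact ht'.1, by rw [hz't]; linarith [ht'.2], fun w hw hrw => hcone w ?_ ?_⟩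
        · rw [hz's, hz't] at hw; linarith [ht'.2]
        · rw [hz'r] at hrw; exact hrw
      have hz'U : z' ∈ U := (hU z').2 (Or.inl hup')
      have hz'W : z' ∈ W := hupW z' hup'.1 hup'.2.2
      refine ⟨hz'U, ?_⟩
      have h := hFvert z hzF (z.1 0 - t') (by linarith [ht'.2]) (by
        convert hz'W using 1; exact Subtype.ext (by show z.1 + (-(z.1 0 - t')) • E4.basisVector 0 = _; rw [neg_sub]))
      convert h using 1; exact Subtype.ext (by show z.1 + (t' - z.1 0) • E4.basisVector 0 = _; rw [neg_sub])
    · rintro z ⟨hzU, -⟩ hzt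
      rw [hΨ'lab z hzU]; exact hagree_low ⟨z, hzU⟩ hzt
  -- hence on `U ∩ Q`
  have hagreeQ : ∀ z : Kerr.region a M, ∀ hz : z ∈ U, z ∈ Q → Θ ⟨z, hz⟩ = Ψ (lab z) := by
    intro z hz hzQ
    rcases hQF hzQ with hzt | hzF
    · exact hagree_low ⟨z, hz⟩ hzt
    · rw [← hΨ'lab z hz]; exact hagreeF z ⟨hz, hzF⟩
  /- ### cross-injectivity -/
  have hΘi' : ∀ y : U, pullbackBilin (I := 𝓡 4) (I' := 𝓘(ℝ, E4)) Θ 𝒱.metric.val y =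
      ((Kerr.spacetime M a M hM.le).metric.restrict PseudoRiemannianMetric.contMDiff_restrict_holds U).val y := hΘi.2
  have hcurve : ∀ z : U, (z.1 : Kerr.region a M) ∉ Q → ∃ y₀ : U, (y₀.1 : Kerr.region a M) ∈ Q ∧
      z ∈ ((Kerr.spacetime M a M hM.le).metric.restrict PseudoRiemannianMetric.contMDiff_restrict_holds
        U).chronologicalFuture ((Kerr.spacetime M a M hM.le).timeOrientation.restrict
          PseudoRiemannianMetric.contMDiff_restrict_holds
          (Kerr.spacetime M a M hM.le).timeOrientation.contMDiff_restrict_holds U) {y₀} := by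
    intro z hzQ
    have hzt : σ < (z.1.1 : E4) 0 := by
      by_contra hle
      push Not at hle
      exact hzQ (hUlowQ z.1 z.2 (lt_of_le_of_lt hle hστ))
    obtain ⟨p, hp, γ, b₀, b₁, hb, hγ, hγp, hγz⟩ :=
      KerrKite.upper_subset_chronologicalFuture_kite hM ha hh hW U hU (show z ∈ Subtype.val ⁻¹' _ from hzt)
    have hpσ : (p.1.1 : E4) 0 = σ := hp
    exact ⟨p, hUlowQ p.1 p.2 (by rw [hpσ]; exact hστ), p, mem_singleton p, γ, b₀, b₁, hb, hγ, hγp, hγz⟩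
  have hagreeU : ∀ z : U, (z.1 : Kerr.region a M) ∈ Q → Θ z = Ψ (lab z.1) := fun z hz => hagreeQ z.1 z.2 hz
  have hcrossU : ∀ (z : U) {x : B.domain}, x ∈ pullK mo M a B Q → Θ z = Ψ x → (z.1 : Kerr.region a M) ∈ Q :=
    fun z x hx hzx => ChartGlue.mem_of_kite_eq (𝒮 := 𝒱.toSpacetime) hM hlab hB hQo he hpast hQI U hΘs hΘi' hΘt
      hagreeU hcurve z hx hzx
  /- ### the point of the chart under a point of the background domain -/
  have hPt : ∀ {S : Set (Kerr.region a M)} {x : B.domain} (hx : x ∈ pullK mo M a B S),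
      ∃ (z : Kerr.region a M), z ∈ S ∧ lab z = x := by
    rintro S x ⟨hreg, hmem⟩
    exact ⟨⟨poincareInv mo.1 mo.2 x.1, hreg⟩, hmem, Subtype.ext (by rw [hlab]; exact F1Route.lab_poincareInv mo x.1)⟩
  -- image of the kite chart
  have hrange : Set.range j ⊆ 𝒱.metric.causalFuture 𝒱.timeOrientation C := by
    rintro _ ⟨y, rfl⟩
    exact himg ⟨lab (jK y), (lab_mem_pullK_iff hlab _).2 (hjQ y), rfl⟩
  have himg' : Ψ' '' pullK mo M a B US ⊆ 𝒱.metric.causalFuture 𝒱.timeOrientation C := by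
    rintro _ ⟨x, hx, rfl⟩
    obtain ⟨z, hzU, rfl⟩ := hPt hx
    rw [hΨ'lab z hzU]
    by_cases hzt : (z : E4) 0 < τ
    · rw [hagree_low ⟨z, hzU⟩ hzt]
      exact himg ⟨lab z, (lab_mem_pullK_iff hlab z).2 (hUlowQ z hzU hzt), rfl⟩
    · have hzσ : σ < (z : E4) 0 := lt_of_lt_of_le hστ (not_lt.1 hzt)
      have h1 := hΘup ⟨z, hzU⟩ hzσ
      have h2 := LorentzianMetric.chronologicalFuture_mono (g := 𝒱.metric) (τ := 𝒱.timeOrientation) hrange h1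
      rw [LorentzianMetric.chronologicalFuture_causalFuture_eq_of_boundaryless hn1] at h2
      exact LorentzianMetric.chronologicalFuture_subset_causalFuture _ _ _ h2
  /- ### packaging -/
  refine ⟨US, Ψ', U.2, hUW, ?_, hs', he', himg', hd', htop', ?_, ?_, hoff⟩
  · -- covering criterion
    intro x hxW hx1 hx2 hcone
    refine (hU x).2 (Or.inl ⟨hx1, by rw [hσ] at *; linarith, fun z hz hrz => ?_⟩)
    exact hcone z hz hrz
  · -- agreement on `pullK (Q ∩ U)`
    intro x hxQ hxU
    obtain ⟨z, hzU, rfl⟩ := hPt hxU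
    rw [hΨ'lab z hzU]
    exact (hagreeQ z hzU ((lab_mem_pullK_iff hlab z).1 hxQ)).symm
  · -- cross-injectivity
    intro x hxQ x' hx'U hxx'
    obtain ⟨z', hz'U, rfl⟩ := hPt hx'U
    rw [hΨ'lab z' hz'U] at hxx'
    exact (lab_mem_pullK_iff hlab z').2 (hcrossU ⟨z', hz'U⟩ hxQ hxx'.symm)

end StepK

/-- **Registered bookkeeping sub-goal `stub_kerrLevelSubsetSlice` of the line** (brick of the landing of
K2b-5 `stub_marchingLemma`): a point `(σ, z)` of the Kerr star chart `{r > M}` (`M > 0`) has `z` in the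
Kerr–Schild slice `{r > M}` (anchor of this file, whose content is the kite piece of one marching step,
`StepK.kite_step`). [folklore] -/
theorem stub_kerrLevelSubsetSlice : ∀ (M a σ : ℝ), 0 < M → ∀ z : E3,
    E4.ofTimeSpace σ z ∈ Kerr.region a M → z ∈ Kerr.slice a M := by
  intro M a σ hM z hz
  rw [Kerr.mem_slice_iff_ofTimeSpace_mem_region, Kerr.mem_region, max_eq_left hM.le,
    ← Kerr.radius_eq_of_spatial_eq a (x := E4.ofTimeSpace σ z) (by rw [E4.spatial_ofTimeSpace, E4.spatial_ofTimeSpace])]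
  rw [Kerr.mem_region, max_eq_left hM.le] at hz; exact hz

end Summit.FinalStateConjecture.FinalStateConjecture.Theorems.BondiBartnikRigidity.DirectMethod

end
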